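import Summits.QuantumFields.QCD.Theses.GapBuysCauchyRate
import Literature.MathematicalPhysics.QuantumFieldTheory.GaugeCovariantBlockMap
import Literature.MathematicalPhysics.QuantumFieldTheory.QCDFlavourSymmetry

/-!
# Stub `stub_onePointFlavour` of line `birth` for crux `GapBuysCauchyRate.LadderCauchyRate`
(item stmt-QuantumFields-17307, route route-QuantumFields-GapBuysCauchyRate, sub-problem QCD)

What is proved: on every torus of side `2S+1`, at every inverse bare coupling `β` and for ALL
(flavour-dependent) bare Wilson masses `m_f`, the honest lattice QCD one-point expectations
`qcdTorusExpect β (2S+1) m (fun U => insertion U s 0)` of the flavour-CHANGING pseudoscalar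
species `s = pseudoRe f g`, `s = pseudoIm f g` (`f ≠ g`) vanish, and so does the one of
`pseudoIm f f` (which is literally the zero Grassmann element, `(-i/2) • (P_{ff} - P_{ff})`).

How: exact vector flavour symmetry `U(1)^{N_f}` of Wilson lattice QCD (Montvay–Münster §5.1.1,
(5.6); tree file `QCDFlavourSymmetry`). The pseudoscalar bilinear `P_{fg}(x) = ψ̄_f iγ₅ ψ_g (x)` is
an eigenvector of the torus action `fermiFlavourScale t` (`ψ̄_f ↦ t_f⁻¹ ψ̄_f`, `ψ_g ↦ t_g ψ_g`) with
eigenvalue `t_f⁻¹ t_g` (`fermiFlavourScale_pseudoscalarBilinear`, from `fermiFlavourScale_qbar/_q`).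
For `f ≠ g` the flavour phase `t_f = -1`, `t_h = 1` (`h ≠ f`) gives BOTH `P_{fg}` and `P_{gf}` the
eigenvalue `-1 ≠ 1`, hence also their hermitian combinations `insertion U (pseudoRe/pseudoIm f g)`;
the selection rule `qcdTorusExpect_eq_zero_of_fermiFlavourScale` (invariance of the Berezin
measure and of the flavour-diagonal Wilson–Dirac Boltzmann factor) kills the expectation. The zero
field `pseudoIm f f` is the eigenvector `0` of `t = 1` for any eigenvalue, e.g. `-1`.

Pure theorem file (no definitions): the registered stub signature, proved in tree vocabulary.
-/

noncomputable section

namespace Summit.QuantumFields.QCD.Cruxes.LadderCauchyRate.Birth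

open scoped BigOperators Topology Classical
open MeasureTheory Filter
open Literature.MathematicalPhysics.AQFT Literature.Probability.LatticeModels
  Literature.MathematicalPhysics.QuantumLattice Literature.MathematicalPhysics.QuantumFieldTheory
open Summit.QuantumFields.QCD.Theses.GapBuysCauchyRate

/-- The pseudoscalar bilinear `P_{fg}(x) = ∑ ψ̄_{f,x,a,α} (iγ₅)_{αβ} ψ_{g,x,a,β}` is an eigenvector of
the vector flavour torus `fermiFlavourScale t` with eigenvalue `t_f⁻¹ t_g` (flavour charge
`-1` in `f`, `+1` in `g`). -/
private theorem fermiFlavourScale_pseudoscalarBilinear {Nf L : ℕ} [NeZero L] (t : Fin Nf → ℂ)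
    (f g : Fin Nf) (x : TorusSite 4 L) :
    fermiFlavourScale t (pseudoscalarBilinear f g x) =
      ((t f)⁻¹ * t g) • pseudoscalarBilinear f g x := by
  simp only [pseudoscalarBilinear, map_sum, map_smul, map_mul, fermiFlavourScale_qbar,
    fermiFlavourScale_q, smul_mul_smul_comm, Finset.smul_sum]
  refine Finset.sum_congr rfl fun a _ => Finset.sum_congr rfl fun α _ =>
    Finset.sum_congr rfl fun β _ => ?_
  exact smul_comm _ _ _

/-- A flavour phase separating `f` from `g ≠ f`: `t_f = -1`, `t_h = 1` for `h ≠ f`, all entries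
non-zero. -/
private theorem exists_flavourPhase {Nf : ℕ} {f g : Fin Nf} (hfg : f ≠ g) :
    ∃ t : Fin Nf → ℂ, t f = -1 ∧ t g = 1 ∧ ∀ h, t h ≠ 0 := by
  refine ⟨fun h => if h = f then -1 else 1, if_pos rfl, if_neg (Ne.symm hfg), fun h => ?_⟩
  show (if h = f then (-1 : ℂ) else 1) ≠ 0
  split_ifs
  · exact neg_ne_zero.2 one_ne_zero
  · exact one_ne_zero

/-- (C) **flavour: the flavour-changing pseudoscalar one-point expectations vanish** (size S/M,
provable now: `qcdTorusExpect_eq_zero_of_fermiFlavourScale`), and `pseudoIm f f` is the zero field. -/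
theorem stub_onePointFlavour :
    ∀ (Nf S : ℕ) (β : ℝ) (mq : Fin Nf → ℝ),
      (∀ f g : Fin Nf, f ≠ g →
        qcdTorusExpect β (2 * S + 1) mq (fun U => insertion U (QCDField.pseudoRe f g) 0) = 0 ∧
        qcdTorusExpect β (2 * S + 1) mq (fun U => insertion U (QCDField.pseudoIm f g) 0) = 0) ∧
      ∀ f : Fin Nf, qcdTorusExpect β (2 * S + 1) mq (fun U => insertion U (QCDField.pseudoIm f f) 0) = 0 := by
  intro Nf S β mq
  have hc : (-1 : ℂ) ≠ 1 := by norm_num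
  refine ⟨fun f g hfg => ?_, fun f => ?_⟩
  · obtain ⟨t, htf, htg, ht⟩ := exists_flavourPhase hfg
    -- both `P_{fg}` and `P_{gf}` carry the flavour phase `-1`
    have hPfg : ∀ x : TorusSite 4 (2 * S + 1),
        fermiFlavourScale t (pseudoscalarBilinear f g x) = (-1 : ℂ) • pseudoscalarBilinear f g x := by
      intro x
      rw [fermiFlavourScale_pseudoscalarBilinear, htf, htg, mul_one, inv_neg, inv_one]
    have hPgf : ∀ x : TorusSite 4 (2 * S + 1),
        fermiFlavourScale t (pseudoscalarBilinear g f x) = (-1 : ℂ) • pseudoscalarBilinear g f x := by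
      intro x
      rw [fermiFlavourScale_pseudoscalarBilinear, htg, htf, inv_one, one_mul]
    refine ⟨qcdTorusExpect_eq_zero_of_fermiFlavourScale ht hc β mq _ fun U => ?_,
      qcdTorusExpect_eq_zero_of_fermiFlavourScale ht hc β mq _ fun U => ?_⟩
    · simp only [insertion]
      rw [map_smul, map_add, hPfg, hPgf, ← smul_add]
      exact smul_comm _ _ _
    · simp only [insertion]
      rw [map_smul, map_sub, hPfg, hPgf, ← smul_sub]
      exact smul_comm _ _ _
  · -- `insertion U (pseudoIm f f) 0 = (-I/2) • (P_{ff} - P_{ff}) = 0`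
    refine qcdTorusExpect_eq_zero_of_fermiFlavourScale (t := fun _ => 1) (fun _ => one_ne_zero)
      hc β mq _ fun U => ?_
    simp only [insertion, sub_self, smul_zero, map_zero]

end Summit.QuantumFields.QCD.Cruxes.LadderCauchyRate.Birth

end
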